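import Mathlib.Algebra.BigOperators.Intervals
import Mathlib.Algebra.Star.Basic
import Mathlib.LinearAlgebra.Matrix.Determinant.Basic
import Mathlib.Tactic.FieldSimp
import Mathlib.Tactic.LinearCombination
import Mathlib.Tactic.Ring
import HarnessLib

/-!
# Gauss-period descent: the algebraic skeleton of THEOREM C∘ (WEIL-2 gen 37, CIRCLE-G37 §3–§4, fact-free)

research route, not a corollary; conditional on HC_CM plus one named minimal statement.

Cell `pub-hodge-ring2-ab-*` (ALL ABELIAN VARIETIES), seat WEIL-2 gen 37, account
`run/shared/lean/pub/pub-hodge-ring2/pub-hodge-ring2-ab-weil-2/CIRCLE-G37.md`.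

Informal setting.  For the metacyclic group `G = ℤ/f ⋊ H`, `h ∈ H` of order `m`, and the three-point datum
`D₃(h; a, c) = (x^a s_h, x^b s_h^{-1}, x^c)`, the Weil discriminant class of the `τ`-piece is the class of the hermitian
determinant of the `L_h`-form `U' = Fix(T)` of the `ψ`-eigenspace `U` of a `μ_f`-cover of `ℙ¹_w` branched on the circle
configuration `{ζ_m^t r} (∪ {0, ∞})`, where `T = σ_h ∘ (s_h)_*` is `σ_h`-semilinear of order `m` (CIRCLE-G37 §2, THEOREM C∘).
On the top exterior power this is a ONE-dimensional descent problem: if `e` spans `Λ^d U`, `h(e,e) = α` and `Λ^d T(e) = μ e`, then the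
descended line is spanned by `π e` with `π = μ · σ(π)` and its Gram determinant is `Δ = α · π · π̄`; `π` is produced by the
explicit Hilbert-90 sum `π = Σ_{k<m} (μ σμ ⋯ σ^{k-1}μ) · σ^k(θ)` (a twisted Gauss period when `μ` is a root of unity), and `α`
is an Aomoto–Kita continuant — for the circle with both centres branched, the TWISTED CYCLIC continuant of §3 below
(LEMMA AK″: `det = (−1)^m (u c₀⋯c_{m−1} − 1)(u^{-1} − 1)/∏(c_t − 1)`).  This file proves, over arbitrary commutative rings /
fields: (1) the explicit Hilbert-90 identity, (2) the `σ`-invariance and basis-independence of `Δ`, (3) LEMMA AK″ for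
`m = 2, 3` as identities of rational functions (the general `m` is proved in the account by a change of basis from the path
continuant, and verified exactly on 24 824 engine data).

0 sorry, no `def`, no named fact; `HC_CM` does not occur.
-/

open Finset

namespace Summit.HodgeConjecture.Ring2AbelianAll.GaussPeriodDescent

section hilbert90

variable {R : Type*} [CommRing R]

/-- Iterating a ring endomorphism: `(τ^(k+1)) x = τ ((τ^k) x)`.  [locator CIRCLE-G37 §4 (H90)]
research route, not a corollary; conditional on HC_CM plus one named minimal statement. -/
theorem pow_succ_apply (τ : R →+* R) (k : ℕ) (x : R) : (τ ^ (k + 1)) x = τ ((τ ^ k) x) := by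
  rw [pow_succ', RingHom.mul_def, RingHom.comp_apply]

/-- The partial twisted norms `a_k = ∏_{i<k} τ^i(z)` satisfy `z · τ(a_k) = a_{k+1}`.  [locator CIRCLE-G37 §4 (H90)]
research route, not a corollary; conditional on HC_CM plus one named minimal statement. -/
theorem mul_map_twistedNorm (τ : R →+* R) (z : R) (k : ℕ) :
    z * τ (∏ i ∈ range k, (τ ^ i) z) = ∏ i ∈ range (k + 1), (τ ^ i) z := by
  rw [map_prod, prod_range_succ' (fun i => (τ ^ i) z)]
  simp only [pow_succ_apply, pow_zero, RingHom.coe_one, id_eq]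
  ring

/-- **Explicit Hilbert 90 for a cyclic endomorphism (the twisted Gauss period).**  Let `τ` be a ring endomorphism with
`τ^m = 1` and `z` an element of twisted norm `z · τ(z) ⋯ τ^{m−1}(z) = 1`.  Then for EVERY `θ` the twisted average
`π(θ) = Σ_{k<m} a_k · τ^k(θ)`, `a_k = ∏_{i<k} τ^i(z)`, satisfies `z · τ(π) = π` (so `z = π/τ(π)` whenever `π` is a unit; in the
account `τ = σ_h` on `ℚ(ζ_f)`, `z = μ = ±ζ^j`, `θ = ζ^k`, and `π` is a twisted Gauss period).  [locator CIRCLE-G37 §4 (H90)]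
research route, not a corollary; conditional on HC_CM plus one named minimal statement. -/
theorem hilbert90_twistedSum (τ : R →+* R) (m : ℕ) (z θ : R) (hτ : ∀ x, (τ ^ m) x = x)
    (hN : ∏ i ∈ range m, (τ ^ i) z = 1) :
    z * τ (∑ k ∈ range m, (∏ i ∈ range k, (τ ^ i) z) * (τ ^ k) θ) =
      ∑ k ∈ range m, (∏ i ∈ range k, (τ ^ i) z) * (τ ^ k) θ := by
  set g : ℕ → R := fun k => (∏ i ∈ range k, (τ ^ i) z) * (τ ^ k) θ with hg
  have hshift : ∀ k, z * τ (g k) = g (k + 1) := by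
    intro k
    simp only [hg, map_mul, ← pow_succ_apply]
    rw [← mul_assoc, mul_map_twistedNorm]
  have hlhs : z * τ (∑ k ∈ range m, g k) = ∑ k ∈ range m, g (k + 1) := by
    rw [map_sum, mul_sum]
    exact sum_congr rfl fun k _ => hshift k
  have h1 := sum_range_succ' g m
  have h2 := sum_range_succ g m
  have hg0 : g 0 = θ := by simp [hg]
  have hgm : g m = θ := by simp only [hg, hN, hτ, one_mul]
  rw [hlhs]
  linear_combination h2 - h1 - hg0 + hgm

end hilbert90

section descent

variable {F : Type*} [Field F] [StarRing F]

/-- **One-dimensional descent: `σ`-invariance of the descended determinant.**  If the top-exterior-power generator `e` has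
`h(e, e) = α`, `Λ^d T(e) = μ e` with `T` an isometry up to `σ` (`σ(α) = μ μ̄ α`) and `π = μ σ(π)` (the fixed vector `π e`), then
`Δ = α π π̄` is `σ`-invariant.  (`σ` commutes with the conjugation.)  [locator CIRCLE-G37 §4 (D1)]
research route, not a corollary; conditional on HC_CM plus one named minimal statement. -/
theorem descendedDet_fixed (σ : F →+* F) (hσ : ∀ x, σ (star x) = star (σ x)) (α μ π : F) (hμ : μ ≠ 0)
    (hα : σ α = μ * star μ * α) (hπ : π = μ * σ π) :
    σ (α * (π * star π)) = α * (π * star π) := by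
  have hsπ : σ π = μ⁻¹ * π := by
    rw [eq_inv_mul_iff_mul_eq₀ hμ]; exact hπ.symm
  have hμs : star μ ≠ 0 := star_ne_zero.mpr hμ
  rw [map_mul, map_mul, hσ, hsπ, hα, star_mul, star_inv₀]
  field_simp

/-- **One-dimensional descent: basis independence.**  Changing the `L`-basis of `U` by a matrix of determinant `q` replaces
`(α, μ, π)` by `(α q q̄, μ σ(q)/q, π/q)`; the descended determinant `α π π̄` is unchanged.  [locator CIRCLE-G37 §4 (D2)]
research route, not a corollary; conditional on HC_CM plus one named minimal statement. -/
theorem descendedDet_basis_invariant (α π q : F) (hq : q ≠ 0) :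
    (α * (q * star q)) * ((π / q) * star (π / q)) = α * (π * star π) := by
  have hqs : star q ≠ 0 := star_ne_zero.mpr hq
  rw [star_div₀]
  field_simp

omit [StarRing F] in
/-- The new multiplier `μ' = μ σ(q)/q` and the new fixed generator `π' = π/q` are again related by `π' = μ' σ(π')`.
[locator CIRCLE-G37 §4 (D2)]  research route, not a corollary; conditional on HC_CM plus one named minimal statement. -/
theorem descendedDet_basis_invariant_fixed (σ : F →+* F) (μ π q : F) (hq : q ≠ 0) (hσq : σ q ≠ 0)
    (hπ : π = μ * σ π) : π / q = (μ * σ q / q) * σ (π / q) := by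
  have key : (μ * σ q / q) * (σ π / σ q) = μ * σ π / q := by
    field_simp
  rw [map_div₀, key, ← hπ]

end descent

/-! ### LEMMA AK″: the twisted cyclic continuant (`m = 2, 3`)

The Gram matrix of the `m` circle eigencycles `E_{L_0}, …, E_{L_{m−1}}` (local monodromies `c_t` at the points `Q_t`,
indices mod `m`, centre twist `u = ζ^{e(0)}`) has diagonal `−(c_t c_{t+1} − 1)/((c_t − 1)(c_{t+1} − 1))`, entries
`c_{t+1}/(c_{t+1} − 1)` at `(t, t+1)` and `1/(c_{t+1} − 1)` at `(t+1, t)`, the pair through `Q_0` (`t + 1 ≡ 0`) twisted by `u` and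
`u^{-1}`.  Its determinant is `(−1)^m (u c_0 ⋯ c_{m−1} − 1)(u^{-1} − 1)/∏_t (c_t − 1)` — an identity of rational functions. -/

section cyclic

variable {F : Type*} [Field F]

/-- **LEMMA AK″, `m = 2`.**  Placement of the centre twist (F-ab-189): the corner entry `(m−1, 0) = (1, 0)` carries
`c₀ u/(c₀ − 1)` and the corner entry `(0, m−1) = (0, 1)` carries `u⁻¹/(c₀ − 1)` (added to the path entries `1/(c₁ − 1)` resp.
`c₁/(c₁ − 1)`, since for `m = 2` the two arcs meet at both points); the identity holds for THIS assignment — exchanging `u` and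
`u⁻¹` changes the determinant.  [locator CIRCLE-G37 §3 LEMMA AK″]
research route, not a corollary; conditional on HC_CM plus one named minimal statement. -/
theorem det_cyclicGram_two (c₀ c₁ u : F) (h₀ : c₀ ≠ 1) (h₁ : c₁ ≠ 1) (hu : u ≠ 0) :
    (!![-(c₀ * c₁ - 1) / ((c₀ - 1) * (c₁ - 1)), c₁ / (c₁ - 1) + u⁻¹ / (c₀ - 1);
        1 / (c₁ - 1) + c₀ * u / (c₀ - 1), -(c₁ * c₀ - 1) / ((c₁ - 1) * (c₀ - 1))] : Matrix (Fin 2) (Fin 2) F).det =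
      (u * (c₀ * c₁) - 1) * (u⁻¹ - 1) / ((c₀ - 1) * (c₁ - 1)) := by
  have h₀' : c₀ - 1 ≠ 0 := sub_ne_zero.mpr h₀
  have h₁' : c₁ - 1 ≠ 0 := sub_ne_zero.mpr h₁
  rw [Matrix.det_fin_two_of]
  field_simp
  ring

/-- **LEMMA AK″, `m = 3`.**  Placement of the centre twist (F-ab-189): the corner entry `(m−1, 0) = (2, 0)` is `c₀ u/(c₀ − 1)`
and the corner entry `(0, m−1) = (0, 2)` is `u⁻¹/(c₀ − 1)` (the slit `I` at `Q_0` lies between the rays of the closing arc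
`C = L_{m−1}` and `L_0`, CIRCLE-G37 §2.3); the identity holds for THIS assignment only.  [locator CIRCLE-G37 §3 LEMMA AK″]
research route, not a corollary; conditional on HC_CM plus one named minimal statement. -/
theorem det_cyclicGram_three (c₀ c₁ c₂ u : F) (h₀ : c₀ ≠ 1) (h₁ : c₁ ≠ 1) (h₂ : c₂ ≠ 1) (hu : u ≠ 0) :
    (!![-(c₀ * c₁ - 1) / ((c₀ - 1) * (c₁ - 1)), c₁ / (c₁ - 1), u⁻¹ / (c₀ - 1);
        1 / (c₁ - 1), -(c₁ * c₂ - 1) / ((c₁ - 1) * (c₂ - 1)), c₂ / (c₂ - 1);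
        c₀ * u / (c₀ - 1), 1 / (c₂ - 1), -(c₂ * c₀ - 1) / ((c₂ - 1) * (c₀ - 1))] : Matrix (Fin 3) (Fin 3) F).det =
      -((u * (c₀ * c₁ * c₂) - 1) * (u⁻¹ - 1)) / ((c₀ - 1) * (c₁ - 1) * (c₂ - 1)) := by
  have h₀' : c₀ - 1 ≠ 0 := sub_ne_zero.mpr h₀
  have h₁' : c₁ - 1 ≠ 0 := sub_ne_zero.mpr h₁
  have h₂' : c₂ - 1 ≠ 0 := sub_ne_zero.mpr h₂
  rw [Matrix.det_fin_three]
  simp only [Matrix.of_apply, Matrix.cons_val', Matrix.cons_val_zero, Matrix.cons_val_one,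
    Matrix.cons_val_two, Matrix.empty_val', Matrix.cons_val_fin_one, Matrix.head_cons, Matrix.head_fin_const,
    Matrix.tail_cons]
  field_simp
  ring

end cyclic

end Summit.HodgeConjecture.Ring2AbelianAll.GaussPeriodDescent
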